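import Summits.Ventures.CertifiedManyBodySolver.Observables.StructureFactorsPositivity
import Mathlib.NumberTheory.LegendreSymbol.AddCharacter

/-!
# M3 observables (iii), file 6: the CONNECTED density structure factor — any constant subtraction
# is invisible at `q ≠ 0`, for every vector

HONEST FRAMING: first certified bounds; not a superconductivity verdict; every number
certified or labelled float.  OBJECTS and exact IDENTITIES only — no bound on any Hubbard state is
claimed here.

Speedrun `mbsolver`, M3 canonical point, stripe-rows seat sr-mbsolver-m3-7 (`STRIPE-ROWS.md` §8,
"not yet in Lean: the connected `S_c` with explicit subtraction"; `M3.md` §2(iii) row ids `Sc.q*`).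

* `blochChar L k` — the Bloch phase `x ↦ e^{iq·x}` (`blochPhase L k`) packaged as an additive
  character of the torus `𝕋_L = (ℤ/Lℤ)²`; `blochChar_ne_one` — it is the trivial character only for
  `k = 0` (injectivity of `ZMod.stdAddChar`);
* **`sum_blochPhase_eq_zero`** — character orthogonality `Σ_x e^{iq·x} = 0` for `q ≠ 0`
  (`AddChar.sum_eq_zero_of_ne_one`), and its conjugate;
* `densityWaveSub L k ν = ρ_ν(q) = Σ_x e^{iq·x} (n_x − ν)` — the density-FLUCTUATION wave for an
  arbitrary subtraction constant `ν ∈ ℂ` (the physical choice is the filling `ν = n = N/L²`);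
  **`densityWaveSub_eq_densityWave`**: `ρ_ν(q) = ρ(q)` for `q ≠ 0`;
* `densityStructureOpSub L k ν = 𝓢_c^ν(q) = Σ_{x,y} e^{iq·x} e^{−iq·y} (n_x − ν)(n_y − ν̄)`,
  `densityStructureOpSub_eq_waves : 𝓢_c^ν(q) = ρ_ν(q) ρ_ν(q)ᴴ`, and
  **`densityStructureOpSub_eq_densityStructureOp : 𝓢_c^ν(q) = 𝓢_c(q)` for `q ≠ 0`**;
* `densityStructureFactorSub L k ν ψ = S_c^ν(q;ψ) = Re ⟨ψ, 𝓢_c^ν(q) ψ⟩ / L²` and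
  **`densityStructureFactorSub_eq_densityStructureFactor : S_c^ν(q;ψ) = S_c(q;ψ)` for `q ≠ 0`,
  every `ψ`, every `ν`** — so an `Sc.q*` row (`q ≠ 0`) of `M3.md` §4 IS a connected
  charge-structure-factor row for any subtraction constant, with NO translation-invariance and NO
  fixed-particle-number hypothesis (the parenthesis in the docstring of `densityStructureFactor`
  is thereby discharged in general).  At `q = 0` the two differ (`ρ_ν(0) = N̂ − νL²`), which is why
  window-TRUNCATED sums `Σ_{|r|≤R} cos(q·r)(C_c(r) − n²)` (TL rows) keep an explicit `n²` term:
  there the subtraction does NOT drop out (`STRIPE-ROWS.md` §1).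
-/

namespace Summit.Ventures.CertifiedManyBodySolver.Observables

open Matrix Literature.MathematicalPhysics.QuantumLattice Literature.Probability.LatticeModels
open Literature.MathematicalPhysics.QuantumLattice.HubbardWave0
open Literature.MathematicalPhysics.QuantumLattice.FermionTorus
open scoped BigOperators ComplexConjugate

noncomputable section

section Connected

variable (L : ℕ) [NeZero L]

/-! ### Character orthogonality on the torus -/

/-- The Bloch phase `x ↦ e^{iq·x}` as an additive character of `𝕋_L = (ℤ/Lℤ)²`. -/
def blochChar (k : TorusSite 2 L) : AddChar (TorusSite 2 L) ℂ where
  toFun := blochPhase L k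
  map_zero_eq_one' := blochPhase_zero_right L k
  map_add_eq_mul' := blochPhase_add L k

/-- `blochChar L k x = e^{iq·x}`. -/
@[simp] theorem blochChar_apply (k x : TorusSite 2 L) : blochChar L k x = blochPhase L k x := rfl

omit [NeZero L] in
/-- `k · e_i = k_i`. -/
theorem torusDot_single (k : TorusSite 2 L) (i : Fin 2) :
    torusDot L k (Pi.single i 1) = k i := by
  simp [torusDot, Pi.single_apply]

/-- `e^{iq·x} ≡ 1` only for `q = 0`: the Bloch character of a non-zero momentum index is
non-trivial (injectivity of `ZMod.stdAddChar`). -/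
theorem blochChar_ne_one {k : TorusSite 2 L} (hk : k ≠ 0) : blochChar L k ≠ 1 := by
  obtain ⟨i, hi⟩ : ∃ i, k i ≠ 0 := by
    by_contra h
    push Not at h
    exact hk (funext h)
  refine AddChar.ne_one_iff.2 ⟨Pi.single i 1, fun h1 => hi ?_⟩
  rw [blochChar_apply, blochPhase, torusDot_single] at h1
  rw [← (ZMod.stdAddChar (N := L)).map_zero_eq_one] at h1
  exact ZMod.injective_stdAddChar h1

/-- **Character orthogonality `Σ_x e^{iq·x} = 0` for `q ≠ 0`.** -/
theorem sum_blochPhase_eq_zero {k : TorusSite 2 L} (hk : k ≠ 0) :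
    ∑ x : TorusSite 2 L, blochPhase L k x = 0 := by
  have h := AddChar.sum_eq_zero_of_ne_one (blochChar_ne_one L hk)
  simpa only [blochChar_apply] using h

/-- `Σ_x e^{−iq·x} = 0` for `q ≠ 0`. -/
theorem sum_star_blochPhase_eq_zero {k : TorusSite 2 L} (hk : k ≠ 0) :
    ∑ x : TorusSite 2 L, star (blochPhase L k x) = 0 := by
  rw [← star_sum, sum_blochPhase_eq_zero L hk, star_zero]

/-- `Σ_x e^{i0·x} = L²` (the `q = 0` peak). -/
theorem sum_blochPhase_zero_left :
    ∑ x : TorusSite 2 L, blochPhase L 0 x = (L : ℂ) ^ 2 := by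
  have h : ∀ x : TorusSite 2 L, blochPhase L 0 x = 1 := fun x => by
    have : torusDot L 0 x = 0 := by simp [torusDot]
    rw [blochPhase, this, AddChar.map_zero_eq_one]
  simp only [h, Finset.sum_const, Finset.card_univ, nsmul_eq_mul, mul_one]
  rw [Fintype.card_pi, Fin.prod_const, ZMod.card]
  push_cast
  rfl

/-! ### The density-fluctuation wave and the connected structure operator -/

/-- **Density-fluctuation wave** `ρ_ν(q) = Σ_x e^{iq·x} (n_x − ν)` for a subtraction constant `ν`
(physically `ν = n = N/L²`, the filling). -/
def densityWaveSub (k : TorusSite 2 L) (ν : ℂ) :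
    Matrix (Finset (Orb (FermionTorus 2 L))) (Finset (Orb (FermionTorus 2 L))) ℂ :=
  ∑ x : TorusSite 2 L, blochPhase L k x • (siteDensity (ofTorusSite x) - ν • (1 : Matrix _ _ ℂ))

/-- `ρ_ν(q) = ρ(q) − ν (Σ_x e^{iq·x}) · 1`. -/
theorem densityWaveSub_eq (k : TorusSite 2 L) (ν : ℂ) :
    densityWaveSub L k ν =
      densityWave L k - ((∑ x : TorusSite 2 L, blochPhase L k x) * ν) • (1 : Matrix _ _ ℂ) := by
  simp only [densityWaveSub, densityWave, smul_sub, Finset.sum_sub_distrib, smul_smul,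
    Finset.sum_mul, Finset.sum_smul]

/-- **`ρ_ν(q) = ρ(q)` for `q ≠ 0`**: the subtraction constant drops out of the wave. -/
theorem densityWaveSub_eq_densityWave {k : TorusSite 2 L} (hk : k ≠ 0) (ν : ℂ) :
    densityWaveSub L k ν = densityWave L k := by
  rw [densityWaveSub_eq, sum_blochPhase_eq_zero L hk, zero_mul, zero_smul, sub_zero]

/-- `ρ_ν(0) = ρ(0) − ν L² · 1` (`ρ(0) = N̂`): at `q = 0` the subtraction survives. -/
theorem densityWaveSub_zero_left (ν : ℂ) :
    densityWaveSub L 0 ν = densityWave L 0 - ((L : ℂ) ^ 2 * ν) • (1 : Matrix _ _ ℂ) := by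
  rw [densityWaveSub_eq, sum_blochPhase_zero_left]

/-- `ρ_ν(q)ᴴ = Σ_y e^{−iq·y} (n_y − ν̄)`. -/
theorem conjTranspose_densityWaveSub (k : TorusSite 2 L) (ν : ℂ) :
    (densityWaveSub L k ν)ᴴ =
      ∑ y : TorusSite 2 L, star (blochPhase L k y) • (siteDensity (ofTorusSite y) - star ν • (1 : Matrix _ _ ℂ)) := by
  simp only [densityWaveSub, Matrix.conjTranspose_sum, Matrix.conjTranspose_smul, Matrix.conjTranspose_sub,
    conjTranspose_siteDensity, Matrix.conjTranspose_one]

/-- **Connected density structure operator** `𝓢_c^ν(q) = Σ_{x,y} e^{iq·x} e^{−iq·y} (n_x − ν)(n_y − ν̄)`. -/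
def densityStructureOpSub (k : TorusSite 2 L) (ν : ℂ) :
    Matrix (Finset (Orb (FermionTorus 2 L))) (Finset (Orb (FermionTorus 2 L))) ℂ :=
  ∑ x : TorusSite 2 L, ∑ y : TorusSite 2 L,
    (blochPhase L k x * star (blochPhase L k y)) •
      ((siteDensity (ofTorusSite x) - ν • (1 : Matrix _ _ ℂ)) * (siteDensity (ofTorusSite y) - star ν • (1 : Matrix _ _ ℂ)))

/-- **`𝓢_c^ν(q) = ρ_ν(q) ρ_ν(q)ᴴ`** (a Gram operator, hence `S_c^ν(q;ψ) ≥ 0` too). -/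
theorem densityStructureOpSub_eq_waves (k : TorusSite 2 L) (ν : ℂ) :
    densityStructureOpSub L k ν = densityWaveSub L k ν * (densityWaveSub L k ν)ᴴ := by
  rw [conjTranspose_densityWaveSub, densityWaveSub, Finset.sum_mul_sum, densityStructureOpSub]
  refine Finset.sum_congr rfl fun x _ => Finset.sum_congr rfl fun y _ => ?_
  rw [smul_mul_smul_comm]

/-- **`𝓢_c^ν(q) = 𝓢_c(q)` for `q ≠ 0`, every `ν`.** -/
theorem densityStructureOpSub_eq_densityStructureOp {k : TorusSite 2 L} (hk : k ≠ 0) (ν : ℂ) :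
    densityStructureOpSub L k ν = densityStructureOp L k := by
  rw [densityStructureOpSub_eq_waves, densityWaveSub_eq_densityWave L hk, densityStructureOp_eq_waves]

/-- **`S_c^ν(q; ψ) = Re ⟨ψ, 𝓢_c^ν(q) ψ⟩ / L²`**, the connected density structure factor of a torus
vector with subtraction constant `ν`. -/
def densityStructureFactorSub (k : TorusSite 2 L) (ν : ℂ) (ψ : Fock (Orb (FermionTorus 2 L))) : ℝ :=
  (expect (densityStructureOpSub L k ν) ψ).re / (L : ℝ) ^ 2

/-- **`S_c^ν(q; ψ) = S_c(q; ψ)` for `q ≠ 0`, every vector `ψ`, every subtraction constant `ν`**: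
an `Sc.q*` row (`q ≠ 0`) is a connected-structure-factor row with no translation-invariance and no
particle-number hypothesis. -/
theorem densityStructureFactorSub_eq_densityStructureFactor {k : TorusSite 2 L} (hk : k ≠ 0) (ν : ℂ)
    (ψ : Fock (Orb (FermionTorus 2 L))) :
    densityStructureFactorSub L k ν ψ = densityStructureFactor L k ψ := by
  rw [densityStructureFactorSub, densityStructureOpSub_eq_densityStructureOp L hk, densityStructureFactor]

open scoped ComplexOrder in
/-- `0 ≤ S_c^ν(q; ψ)` for every `q`, `ν`, `ψ` (Gram form). -/
theorem densityStructureFactorSub_nonneg (k : TorusSite 2 L) (ν : ℂ) (ψ : Fock (Orb (FermionTorus 2 L))) :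
    0 ≤ densityStructureFactorSub L k ν ψ := by
  have h := (Matrix.posSemidef_self_mul_conjTranspose (densityWaveSub L k ν)).dotProduct_mulVec_nonneg ψ
  have hnum : 0 ≤ (expect (densityStructureOpSub L k ν) ψ).re := by
    rw [densityStructureOpSub_eq_waves]
    exact (Complex.nonneg_iff.mp h).1
  exact div_nonneg hnum (pow_nonneg (Nat.cast_nonneg L) 2)

end Connected

end

end Summit.Ventures.CertifiedManyBodySolver.Observables
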